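import Literature.MathematicalPhysics.QuantumManyBody.BoseGasSubcellCondensationSharp
import HarnessLib

/-!
# No clumping of Dirichlet near-minimisers at mesoscopic scales in the dilute limit

Topic `Literature/MathematicalPhysics/QuantumManyBody`, namespace `…BoseGas`; companion of
`BoseGasSubcellCondensation.lean`, `BoseGasSubcellCondensationDilute.lean` and
`BoseGasSubcellCondensationSharp.lean` (support of the crux `BECTangentRigidity.TangentTransfer`,
stmt-AtomisticToContinuum-13033, of the summit `AtomisticToContinuum/BoseEinsteinCondensation`).
Those files prove that the `8^k` sub-cell constant modes of side `s = L/2^k ∈ [M/√ρ, 2M/√ρ)` carry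
all but a fraction `η` of the particles of a near-minimiser of the Dirichlet energy (the floor).
This file proves the complementary upper bound on CLUMPING: distributing the particles of a
configuration over the `8^k` cells of side `s` (assignment `σ`, occupation numbers `n_c(σ)`, weight
`mass_σ = ∫_{cellSet σ}|Ψ|²`), the mass-averaged total excess over the fair share,
`Σ_σ mass_σ Σ_c (n_c(σ) - (1+η)N/8^k)₊`, is at most `ηN` for small `ρ` and large `N`; by Jensen so
is the total excess `Σ_c (N_c - (1+η)N/8^k)₊` of the expected cell numbers `N_c = Σ_σ mass_σ n_c(σ)`
(= `Σ_j ∫_{x_j ∈ C_c}|Ψ|²`, the cells partitioning the box up to a null set).  Since a flat-mode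
occupation is at most the expected number of particles in its cell (the diagonal of the
one-particle density matrix is the density), this bounds the total over-occupation of the flat
cell modes beyond the fair share.

* `occupation_bookkeeping_excess` — the convexity bookkeeping of the cell method
  [LSSY2005, (2.55)–(2.58)] with a crowding penalty, keeping the linear surplus of the
  over-occupied cells: with `n_c` particles in cell `c`, mean `n̄ = N/K³`, `b₀ = (1-θ)(8πa/s³)n̄`,
  `(1-θ)(4πa/s³)N n̄ + b₀η·Σ_c (n_c - (1+η)n̄)₊ ≤ Σ_c lb(n_c) + 2K³λb₀`
  (`Σ_c n_c² = K³n̄² + Σ_c (n_c - n̄)²` and `(n_c - n̄)² ≥ 2ηn̄(n_c - (1+η)n̄)₊`; crowded cells beyond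
  the Lieb–Yngvason regime cost `κ_h ≥ 2b₀` per particle by superadditivity, low cells hold `≤ λ`
  particles);
* `mul_sum_mass_mul_excess_le` — the cell method [LSSY2005, (2.52)] state-wise for a Dirichlet
  state: the mass-averaged excess `⟨Σ_c (n_c - cap)₊⟩_Ψ` is paid for by the budget `U + B - A`;
* `sum_tsub_le_sum_mul_sum_tsub` — Jensen for the truncated excess;
* `crowding_condition`, `noClumpingBudget_le`, `noClumpingParams_eventually` — the side
  conditions and the budget at the mesoscopic scale, small for small `ρ`;
* `sum_mass_mul_excess_le_of_scatteringLength_pos` — the conclusion: for positive scattering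
  length, every `0 < η ≤ 1`, `M > 0` and all `ρ < ρ₀(η, M, v)`, eventually in `N`, every
  `1`-near-minimiser has `Σ_σ mass_σ Σ_c (n_c(σ) - (1+η)N/8^k)₊ ≤ ηN` at every dyadic level `k`
  with `M/√ρ ≤ L/2^k < 2M/√ρ` (the cells hold `n̄ = ρs³ ≥ M³/√ρ → ∞` particles on average; the
  excess is `≤ N(C_u(ρa³)^{1/3} + C₁Y^{1/17} + 4λ̄√ρ/M³)/η + 1/(4πaρη)`), and its Jensen form
  `sum_massAverage_card_tsub_le_of_scatteringLength_pos`: `Σ_c (N_c - (1+η)N/8^k)₊ ≤ ηN`.  The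
  statement is false for zero scattering length (free Dirichlet ground state `∏ sin(πx/L)`: the
  central cells hold up to `8×` the fair share), hence the hypothesis `0 < a`.

No definitions; all constants are explicit or existentially quantified.  Hard cores are allowed.

## References

* [LSSY2005] E. H. Lieb, R. Seiringer, J. P. Solovej, J. Yngvason, *The Mathematics of the Bose
  Gas and its Condensation*, Oberwolfach Seminars 34, Birkhäuser 2005 (arXiv:cond-mat/0610117):
  Thm. 2.2 (2.14), Thm. 2.4 (2.35) and the cell method (2.52)–(2.58), Lemma 5.2 (5.7)–(5.14).
* [LiebYngvason1998] E. H. Lieb, J. Yngvason, *Ground state energy of the low density Bose gas*,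
  Phys. Rev. Lett. 80 (1998) 2504–2507.
-/

noncomputable section

open MeasureTheory Filter Set Metric
open scoped ENNReal NNReal Topology BigOperators

namespace Literature.MathematicalPhysics.QuantumManyBody.BoseGas

/-! ### Occupation bookkeeping over the cells, keeping the linear excess -/

/-- The truncated excess of a natural occupation number over a nonnegative real cap, in `ℝ≥0∞`,
is `ofReal` of the positive part of the real difference. [folklore] -/
theorem natCast_tsub_ofReal (m : ℕ) {cap : ℝ} (hcap : 0 ≤ cap) :
    (m : ℝ≥0∞) - ENNReal.ofReal cap = ENNReal.ofReal (max ((m : ℝ) - cap) 0) := by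
  rw [← ENNReal.ofReal_natCast, ← ENNReal.ofReal_sub _ hcap]
  rcases le_total ((m : ℝ) - cap) 0 with h | h
  · rw [max_eq_right h, ENNReal.ofReal_of_nonpos h, ENNReal.ofReal_zero]
  · rw [max_eq_left h]

/-- **The pointwise cell inequality behind the no-clumping bookkeeping.**  With `q ≥ 0`, mean
occupation `n̄ ≥ 0`, `b₀ = 2qn̄`, `0 ≤ η ≤ 1` and the excess `e = (m - (1+η)n̄)₊`: if `lb(m) ≥ q m²`
on good `m`, `lb(m) ≥ 0` and `m ≤ λ` on low `m`, `lb(m) ≥ κ_h m` with `κ_h ≥ 2b₀` on high `m`, then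
`b₀ m - q n̄² + b₀ η e ≤ lb(m) + 2b₀λ·1[m low]` (good: `m² = n̄² + 2n̄(m-n̄) + (m-n̄)²` and
`(m-n̄)² ≥ 2ηn̄e`; high: `2b₀m ≥ b₀m + b₀ηe`; low: `b₀m + b₀ηe ≤ 2b₀λ`). [folklore] -/
theorem cell_excess_pointwise {mth : ℕ} (good : ℕ → Prop) [DecidablePred good] (lb : ℕ → ℝ)
    {lam q nbar b₀ η κh : ℝ} (hq : 0 ≤ q) (hnbar : 0 ≤ nbar) (hb₀ : b₀ = 2 * q * nbar)
    (hη0 : 0 ≤ η) (hη1 : η ≤ 1)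
    (hgood : ∀ m, good m → q * (m : ℝ) ^ 2 ≤ lb m)
    (hlow : ∀ m, ¬ good m → (m : ℝ) ≤ mth → 0 ≤ lb m ∧ (m : ℝ) ≤ lam)
    (hhigh : ∀ m, ¬ good m → (mth : ℝ) < m → κh * m ≤ lb m)
    (hκ : 2 * b₀ ≤ κh) (m : ℕ) :
    b₀ * m - q * nbar ^ 2 + b₀ * η * max ((m : ℝ) - (1 + η) * nbar) 0 ≤
      lb m + (if ¬ good m ∧ (m : ℝ) ≤ mth then 2 * b₀ * lam else 0) := by
  have hm0 : (0 : ℝ) ≤ m := Nat.cast_nonneg m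
  have hb₀0 : 0 ≤ b₀ := by rw [hb₀]; positivity
  have he0 : 0 ≤ max ((m : ℝ) - (1 + η) * nbar) 0 := le_max_right _ _
  have hem : max ((m : ℝ) - (1 + η) * nbar) 0 ≤ m :=
    max_le (by nlinarith [mul_nonneg hη0 hnbar]) hm0
  have hηe : b₀ * η * max ((m : ℝ) - (1 + η) * nbar) 0 ≤ b₀ * m := by
    calc b₀ * η * max ((m : ℝ) - (1 + η) * nbar) 0
        ≤ b₀ * 1 * max ((m : ℝ) - (1 + η) * nbar) 0 := by gcongr
      _ ≤ b₀ * 1 * m := by gcongr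
      _ = b₀ * m := by ring
  by_cases hg : good m
  · -- good cells: convexity with the linear excess kept
    have hif : (if ¬ good m ∧ (m : ℝ) ≤ mth then 2 * b₀ * lam else 0) = 0 := by simp [hg]
    rw [hif, add_zero]
    have key : 2 * nbar * η * max ((m : ℝ) - (1 + η) * nbar) 0 ≤ ((m : ℝ) - nbar) ^ 2 := by
      rcases le_or_gt ((m : ℝ) - (1 + η) * nbar) 0 with h | h
      · rw [max_eq_right h]; nlinarith [sq_nonneg ((m : ℝ) - nbar)]
      · rw [max_eq_left h.le]
        nlinarith [sq_nonneg ((m : ℝ) - (1 + η) * nbar), sq_nonneg (η * nbar)]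
    have h1 := hgood m hg
    have h2 := mul_le_mul_of_nonneg_left key hq
    rw [hb₀]
    nlinarith
  · by_cases hm : (m : ℝ) ≤ mth
    · -- low cells
      have hif : (if ¬ good m ∧ (m : ℝ) ≤ mth then 2 * b₀ * lam else 0) = 2 * b₀ * lam := by
        simp [hg, hm]
      rw [hif]
      obtain ⟨hlb0, hmlam⟩ := hlow m hg hm
      have h1 : b₀ * m ≤ b₀ * lam := mul_le_mul_of_nonneg_left hmlam hb₀0
      have h2 : 0 ≤ q * nbar ^ 2 := by positivity
      linarith
    · -- high cells
      have hif : (if ¬ good m ∧ (m : ℝ) ≤ mth then 2 * b₀ * lam else 0) = 0 := by simp [hm]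
      rw [hif, add_zero]
      have h1 := hhigh m hg (not_le.1 hm)
      have h2 : 2 * b₀ * m ≤ κh * m := mul_le_mul_of_nonneg_right hκ hm0
      have h3 : 0 ≤ q * nbar ^ 2 := by positivity
      linarith

/-- **Occupation bookkeeping with the linear excess** (the cell-method convexity
[LSSY (2.55)–(2.58)] with a crowding penalty, keeping the surplus of the over-occupied cells).
Distribute `Nt` particles over `Kc` cells, `n_c` in cell `c`, mean `n̄ = Nt/Kc`.  Suppose a real
lower bound `lb` of the cell energies satisfies `lb(m) ≥ (1-θ)(4πa/s³)m²` on `good` occupation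
numbers, `lb(m) ≥ 0` and `m ≤ λ` on the other ("low") ones with `m ≤ mth`, and `lb(m) ≥ κ_h m` on
those with `m > mth` ("high"), where `κ_h ≥ 2b₀`, `b₀ = (1-θ)(8πa/s³)n̄`.  Then for `0 ≤ η ≤ 1`
`(1-θ)(4πa/s³)Nt²/Kc + b₀η · Σ_c (n_c - (1+η)n̄)₊ ≤ Σ_c lb(n_c) + 2Kc·λ·b₀`
(`Σ_c n_c² = Kc n̄² + Σ_c (n_c - n̄)²` and `(n_c - n̄)² ≥ 2ηn̄(n_c - (1+η)n̄)₊`).  Stated in `ℝ≥0∞`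
(truncated subtraction). [folklore] -/
theorem occupation_bookkeeping_excess {Kc Nt mth : ℕ} (good : ℕ → Prop) [DecidablePred good]
    (lb : ℕ → ℝ) {lam θ a s κh η : ℝ} (hs : 0 < s) (ha : 0 ≤ a) (hθ : θ ≤ 1) (hlam : 0 ≤ lam)
    (hη0 : 0 ≤ η) (hη1 : η ≤ 1)
    (hgood : ∀ m, good m → (1 - θ) * (4 * Real.pi * a / s ^ 3) * (m : ℝ) ^ 2 ≤ lb m)
    (hlow : ∀ m, ¬ good m → (m : ℝ) ≤ mth → 0 ≤ lb m ∧ (m : ℝ) ≤ lam)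
    (hhigh : ∀ m, ¬ good m → (mth : ℝ) < m → κh * m ≤ lb m)
    (hκ : 2 * ((1 - θ) * (8 * Real.pi * a / s ^ 3) * ((Nt : ℝ) / Kc)) ≤ κh)
    (nv : Fin Kc → ℕ) (hsum : ∑ c, nv c = Nt) :
    ENNReal.ofReal ((1 - θ) * (4 * Real.pi * a / s ^ 3) * (Nt : ℝ) ^ 2 / Kc) +
        ENNReal.ofReal ((1 - θ) * (8 * Real.pi * a / s ^ 3) * ((Nt : ℝ) / Kc) * η) *
          ∑ c, ((nv c : ℝ≥0∞) - ENNReal.ofReal ((1 + η) * Nt / Kc)) ≤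
      (∑ c, ENNReal.ofReal (lb (nv c))) +
        ENNReal.ofReal (2 * Kc * lam * ((1 - θ) * (8 * Real.pi * a / s ^ 3) * ((Nt : ℝ) / Kc))) := by
  -- trivial when there are no cells
  rcases Nat.eq_zero_or_pos Kc with hK0 | hKpos
  · subst hK0
    simp
  have hKr : (0 : ℝ) < Kc := Nat.cast_pos.2 hKpos
  set q : ℝ := (1 - θ) * (4 * Real.pi * a / s ^ 3) with hq
  have hq0 : 0 ≤ q := by rw [hq]; exact mul_nonneg (by linarith) (by positivity)
  set nbar : ℝ := (Nt : ℝ) / Kc with hnbar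
  have hnbar0 : 0 ≤ nbar := by positivity
  set b₀ : ℝ := (1 - θ) * (8 * Real.pi * a / s ^ 3) * nbar with hb₀
  have hb₀q : b₀ = 2 * q * nbar := by rw [hb₀, hq]; ring
  have hb₀0 : 0 ≤ b₀ := by rw [hb₀q]; positivity
  have hκh : 0 ≤ κh := le_trans (by positivity) hκ
  have hcap0 : 0 ≤ (1 + η) * Nt / Kc := by positivity
  have hcap : (1 + η) * Nt / Kc = (1 + η) * nbar := by rw [hnbar]; ring
  set e : Fin Kc → ℝ := fun c => max ((nv c : ℝ) - (1 + η) * nbar) 0 with he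
  have he0 : ∀ c, 0 ≤ e c := fun c => le_max_right _ _
  -- nonnegativity of all `lb` values
  have hlb0 : ∀ c, 0 ≤ lb (nv c) := by
    intro c
    by_cases hg : good (nv c)
    · exact le_trans (by positivity) (hgood _ hg)
    · rcases le_or_gt (nv c : ℝ) mth with h | h
      · exact (hlow _ hg h).1
      · exact le_trans (by positivity) (hhigh _ hg h)
  -- the pointwise inequality, summed
  have hpt : ∀ c, b₀ * (nv c) - q * nbar ^ 2 + b₀ * η * e c ≤
      lb (nv c) + (if ¬ good (nv c) ∧ ((nv c : ℕ) : ℝ) ≤ mth then 2 * b₀ * lam else 0) := fun c =>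
    cell_excess_pointwise good lb hq0 hnbar0 hb₀q hη0 hη1 hgood hlow hhigh (by rw [hb₀q] at hκ ⊢; exact hκ)
      (nv c)
  have hNt : ∑ c, (nv c : ℝ) = Nt := by rw [← hsum]; push_cast; rfl
  have hKn : (Kc : ℝ) * nbar = Nt := by rw [hnbar]; field_simp
  have hreal : q * (Nt : ℝ) ^ 2 / Kc + b₀ * η * ∑ c, e c ≤ (∑ c, lb (nv c)) + 2 * Kc * lam * b₀ := by
    have h1 := Finset.sum_le_sum fun c (_ : c ∈ Finset.univ) => hpt c
    have hL : ∑ c, (b₀ * (nv c) - q * nbar ^ 2 + b₀ * η * e c) =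
        b₀ * Nt - Kc * (q * nbar ^ 2) + b₀ * η * ∑ c, e c := by
      rw [Finset.sum_add_distrib, Finset.sum_sub_distrib, Finset.sum_const, ← Finset.mul_sum,
        ← Finset.mul_sum, hNt, Finset.card_univ, Fintype.card_fin, nsmul_eq_mul]
    rw [hL, Finset.sum_add_distrib] at h1
    have h2 : ∑ c, (if ¬ good (nv c) ∧ ((nv c : ℕ) : ℝ) ≤ mth then 2 * b₀ * lam else 0) ≤
        ∑ _c : Fin Kc, 2 * b₀ * lam :=
      Finset.sum_le_sum fun c _ => by split_ifs <;> nlinarith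
    rw [Finset.sum_const, Finset.card_univ, Fintype.card_fin, nsmul_eq_mul] at h2
    have h3 : q * (Nt : ℝ) ^ 2 / Kc = b₀ * Nt - Kc * (q * nbar ^ 2) := by
      rw [hb₀q, ← hKn]; field_simp; ring
    rw [h3]
    linarith
  -- conversion to `ℝ≥0∞`
  have hA0 : 0 ≤ q * (Nt : ℝ) ^ 2 / Kc := by positivity
  have hexc : (∑ c, ((nv c : ℝ≥0∞) - ENNReal.ofReal ((1 + η) * Nt / Kc))) = ENNReal.ofReal (∑ c, e c) := by
    rw [ENNReal.ofReal_sum_of_nonneg (fun c _ => he0 c)]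
    refine Finset.sum_congr rfl fun c _ => ?_
    rw [natCast_tsub_ofReal _ hcap0, hcap]
  have hlbE : (∑ c, ENNReal.ofReal (lb (nv c))) = ENNReal.ofReal (∑ c, lb (nv c)) :=
    (ENNReal.ofReal_sum_of_nonneg fun c _ => hlb0 c).symm
  rw [hexc, hlbE, ← ENNReal.ofReal_mul (by positivity), ← ENNReal.ofReal_add hA0 (by positivity),
    ← ENNReal.ofReal_add (Finset.sum_nonneg fun c _ => hlb0 c) (by positivity)]
  exact ENNReal.ofReal_le_ofReal (by simpa [hq, hb₀] using hreal)

/-- **Jensen for the truncated excess.**  For weights `w` with `Σ_s w_s = 1`, the truncated excess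
of an average is at most the average of the truncated excesses:
`Σ_i ((Σ_s w_s f_{s,i}) - c)₊ ≤ Σ_s w_s Σ_i (f_{s,i} - c)₊` (truncated subtraction in `ℝ≥0∞`).
[folklore] -/
theorem sum_tsub_le_sum_mul_sum_tsub {ι S : Type*} [Fintype ι] [Fintype S] (w : S → ℝ≥0∞)
    (hw : ∑ s, w s = 1) (f : S → ι → ℝ≥0∞) (c : ℝ≥0∞) :
    ∑ i, ((∑ s, w s * f s i) - c) ≤ ∑ s, w s * ∑ i, (f s i - c) := by
  calc ∑ i, ((∑ s, w s * f s i) - c) ≤ ∑ i, ∑ s, w s * (f s i - c) := by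
        refine Finset.sum_le_sum fun i _ => ?_
        rw [tsub_le_iff_right]
        calc ∑ s, w s * f s i ≤ ∑ s, (w s * (f s i - c) + w s * c) := by
              refine Finset.sum_le_sum fun s _ => ?_
              rw [← mul_add]
              gcongr
              exact le_tsub_add
          _ = ∑ s, w s * (f s i - c) + c := by
              rw [Finset.sum_add_distrib, ← Finset.sum_mul, hw, one_mul]
    _ = ∑ s, w s * ∑ i, (f s i - c) := by
        rw [Finset.sum_comm]
        simp_rw [Finset.mul_sum]

/-! ### The expected excess of a Dirichlet state: cell method -/

section Deterministic

variable {N K : ℕ} {s L : ℝ}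

/-- The localized functional is below the Neumann energy, hence so are the infima:
`E'(ε, R; n, ℓ) ≤ E₀^Neu(n, ℓ)` for `0 ≤ ε ≤ 1`. [cite: LSSY2005, Lemma 5.2 (5.9)] -/
theorem locGroundStateEnergy_le_neumannGroundStateEnergy {ε : ℝ} (hε0 : 0 ≤ ε) (hε1 : ε ≤ 1)
    (R : ℝ) (v : ℝ → ℝ≥0∞) (n : ℕ) (ℓ : ℝ) :
    locGroundStateEnergy ε R v n ℓ ≤ neumannGroundStateEnergy v n ℓ :=
  le_iInf fun Ψ => (locGroundStateEnergy_le ε R v Ψ).trans (locEnergy_le_neumannEnergy hε0 hε1 R v Ψ)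

/-- **The expected excess is paid for by the energy budget.**  Let `Ψ` be a Dirichlet state of
`Λ_L`, `L = Ks`, with energy `≤ U`, and let `lb(m) ≤ E₀^Neu(m, s)` be a real lower bound of the
Neumann cell energies.  If the occupation bookkeeping
`A + P · Σ_c (n_c - cap)₊ ≤ Σ_c lb(n_c) + B` holds for every distribution of the `N` particles over
the `K³` cells, then the mass-averaged excess `⟨Σ_c (n_c - cap)₊⟩_Ψ = Σ_σ (∫_{cellSet σ}|Ψ|²) Σ_c (n_c(σ) - cap)₊`
satisfies `P · ⟨Σ_c (n_c - cap)₊⟩_Ψ ≤ U + B - A` (cell method: `Σ_σ Σ_c E₀^Neu(n_c(σ), s)·mass_σ ≤ ⟨Ψ, HΨ⟩`,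
`Σ_σ mass_σ = 1`). [cite: LSSY2005, (2.52)] -/
theorem mul_sum_mass_mul_excess_le (hs : 0 < s) (hK : 0 < K) (hKs : (K : ℝ) * s = L)
    {v : ℝ → ℝ≥0∞} (hv : Measurable v) (Ψ : TrialState N L) (lb : ℕ → ℝ) {cap P Ur A B : ℝ}
    (hUr : 0 ≤ Ur) (hA : 0 ≤ A) (hB : 0 ≤ B)
    (hlbN : ∀ m, ENNReal.ofReal (lb m) ≤ neumannGroundStateEnergy v m s)
    (hcomb : ∀ nv : Fin (K ^ 3) → ℕ, ∑ c, nv c = N →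
      ENNReal.ofReal A + ENNReal.ofReal P * ∑ c, ((nv c : ℝ≥0∞) - ENNReal.ofReal cap) ≤
        (∑ c, ENNReal.ofReal (lb (nv c))) + ENNReal.ofReal B)
    (hE : energy v Ψ ≤ ENNReal.ofReal Ur) :
    ENNReal.ofReal P * ∑ σ : Fin N → Fin (K ^ 3),
        (∫⁻ X in cellSet K s σ, (‖Ψ.ψ X‖₊ : ℝ≥0∞) ^ 2) *
          ∑ c, (((Finset.univ.filter fun i => σ i = c).card : ℝ≥0∞) - ENNReal.ofReal cap) ≤
      ENNReal.ofReal (Ur + B - A) := by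
  set mass : (Fin N → Fin (K ^ 3)) → ℝ≥0∞ := fun σ =>
    ∫⁻ X in cellSet K s σ, (‖Ψ.ψ X‖₊ : ℝ≥0∞) ^ 2 with hmass
  set Xs : (Fin N → Fin (K ^ 3)) → ℝ≥0∞ := fun σ =>
    ∑ c, (((Finset.univ.filter fun i => σ i = c).card : ℝ≥0∞) - ENNReal.ofReal cap) with hXs
  have hmass1 : ∑ σ : Fin N → Fin (K ^ 3), mass σ = 1 := sum_mass_cellSet_eq_one hs hK hKs Ψ
  have hsum_card : ∀ σ : Fin N → Fin (K ^ 3),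
      ∑ c, (Finset.univ.filter fun i => σ i = c).card = N := fun σ =>
    (Finset.card_eq_sum_card_fiberwise (f := σ) (s := Finset.univ) (t := Finset.univ)
      fun _ _ => Finset.mem_univ _).symm.trans (by simp)
  -- the cell method: `Λ = Σ_σ (Σ_c lb(n_c)) mass_σ ≤ energy ≤ U`
  set Λ : ℝ≥0∞ := ∑ σ : Fin N → Fin (K ^ 3),
    (∑ c, ENNReal.ofReal (lb (Finset.univ.filter fun i => σ i = c).card)) * mass σ with hΛ
  have hΛU : Λ ≤ ENNReal.ofReal Ur := by
    calc Λ ≤ ∑ σ : Fin N → Fin (K ^ 3),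
          (∑ c, neumannGroundStateEnergy v (Finset.univ.filter fun i => σ i = c).card s) * mass σ := by
          refine Finset.sum_le_sum fun σ _ => mul_le_mul_left (Finset.sum_le_sum fun c _ => hlbN _) _
      _ ≤ ∑ σ : Fin N → Fin (K ^ 3), ∫⁻ X in cellSet K s σ,
          kineticDensity Ψ.ψ X + interaction v X * (‖Ψ.ψ X‖₊ : ℝ≥0∞) ^ 2 :=
          Finset.sum_le_sum fun σ _ =>
            sum_neumannGroundStateEnergy_mul_le_setLIntegral_cellSet hv Ψ.contDiff σ
      _ = ∫⁻ X in ⋃ σ : Fin N → Fin (K ^ 3), cellSet K s σ,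
          kineticDensity Ψ.ψ X + interaction v X * (‖Ψ.ψ X‖₊ : ℝ≥0∞) ^ 2 := by
          rw [lintegral_iUnion (fun σ => measurableSet_cellSet K s σ) (pairwiseDisjoint_cellSet hs),
            tsum_fintype]
      _ ≤ energy v Ψ := setLIntegral_le_lintegral _ _
      _ ≤ ENNReal.ofReal Ur := hE
  -- the bookkeeping, averaged
  have h4c : ENNReal.ofReal A + ENNReal.ofReal P * ∑ σ : Fin N → Fin (K ^ 3), mass σ * Xs σ ≤
      Λ + ENNReal.ofReal B := by
    have hσ : ∀ σ : Fin N → Fin (K ^ 3),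
        (ENNReal.ofReal A + ENNReal.ofReal P * Xs σ) * mass σ ≤
          ((∑ c, ENNReal.ofReal (lb (Finset.univ.filter fun i => σ i = c).card)) +
            ENNReal.ofReal B) * mass σ := fun σ =>
      mul_le_mul_left (hcomb (fun c => (Finset.univ.filter fun i => σ i = c).card) (hsum_card σ)) _
    have := Finset.sum_le_sum fun σ (_ : σ ∈ Finset.univ) => hσ σ
    calc ENNReal.ofReal A + ENNReal.ofReal P * ∑ σ : Fin N → Fin (K ^ 3), mass σ * Xs σ
        = ∑ σ : Fin N → Fin (K ^ 3), (ENNReal.ofReal A + ENNReal.ofReal P * Xs σ) * mass σ := by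
          have h1 : ∑ σ : Fin N → Fin (K ^ 3), (ENNReal.ofReal A + ENNReal.ofReal P * Xs σ) * mass σ =
              ENNReal.ofReal A * ∑ σ : Fin N → Fin (K ^ 3), mass σ +
                ENNReal.ofReal P * ∑ σ : Fin N → Fin (K ^ 3), mass σ * Xs σ := by
            rw [Finset.mul_sum, Finset.mul_sum, ← Finset.sum_add_distrib]
            exact Finset.sum_congr rfl fun σ _ => by ring
          rw [h1, hmass1, mul_one]
      _ ≤ ∑ σ : Fin N → Fin (K ^ 3),
          ((∑ c, ENNReal.ofReal (lb (Finset.univ.filter fun i => σ i = c).card)) +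
            ENNReal.ofReal B) * mass σ := this
      _ = Λ + ENNReal.ofReal B := by
          rw [hΛ]
          simp only [add_mul, Finset.sum_add_distrib, ← Finset.mul_sum, hmass1, mul_one]
  have h4d : ENNReal.ofReal A + ENNReal.ofReal P * ∑ σ : Fin N → Fin (K ^ 3), mass σ * Xs σ ≤
      ENNReal.ofReal (Ur + B) := by
    calc _ ≤ Λ + ENNReal.ofReal B := h4c
      _ ≤ ENNReal.ofReal Ur + ENNReal.ofReal B := add_le_add hΛU le_rfl
      _ = ENNReal.ofReal (Ur + B) := (ENNReal.ofReal_add hUr hB).symm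
  rw [ENNReal.ofReal_sub _ hA]
  exact ENNReal.le_sub_of_add_le_left ENNReal.ofReal_ne_top h4d

end Deterministic

/-! ### The crowding condition and the budget at the mesoscopic scale -/

section Budget

variable {a M ρ s : ℝ}

/-- **The crowding condition** `2b₀ ≤ κ_h`: twice the mean-field cost `b₀ = (1-θ)8πaρ ≤ 8πaρ` per
particle is below the superadditivity penalty `κ_h = πa·mth/s³ ≥ πa√ρ/(8M³)` of the crowded cells
(`mth ≥ ρ⁻¹`, `s ≤ 2M/√ρ`) as soon as `128M³√ρ ≤ 1`. [folklore] -/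
theorem crowding_condition {θ : ℝ} {mth : ℕ} (ha : 0 < a) (hM : 0 < M) (hρ : 0 < ρ)
    (hsu : s ≤ 2 * M / Real.sqrt ρ) (hs : 0 < s) (hθ0 : 0 ≤ θ)
    (hmth : ρ⁻¹ ≤ (mth : ℝ)) (hpar : 128 * M ^ 3 * Real.sqrt ρ ≤ 1) :
    2 * ((1 - θ) * (8 * Real.pi * a / s ^ 3) * (ρ * s ^ 3)) ≤ Real.pi * a * mth / s ^ 3 := by
  have hsr : 0 < Real.sqrt ρ := Real.sqrt_pos.2 hρ
  have hs3 := le_inv_cube_of_scale hM hρ hsu hs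
  -- left side ≤ 16πaρ
  have h1 : 2 * ((1 - θ) * (8 * Real.pi * a / s ^ 3) * (ρ * s ^ 3)) ≤ 16 * Real.pi * a * ρ := by
    have e2 : (1 - θ) * (8 * Real.pi * a / s ^ 3) * (ρ * s ^ 3) = (1 - θ) * (8 * Real.pi * a * ρ) := by
      field_simp
    rw [e2]
    have h4 : (1 - θ) * (8 * Real.pi * a * ρ) ≤ 1 * (8 * Real.pi * a * ρ) :=
      mul_le_mul_of_nonneg_right (by linarith) (by positivity)
    linarith
  -- right side ≥ πa√ρ/(8M³)
  have h2 : Real.pi * a * Real.sqrt ρ / (8 * M ^ 3) ≤ Real.pi * a * mth / s ^ 3 := by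
    calc Real.pi * a * Real.sqrt ρ / (8 * M ^ 3) = Real.pi * a * (ρ * Real.sqrt ρ / (8 * M ^ 3)) * ρ⁻¹ := by
          field_simp
      _ ≤ Real.pi * a * (1 / s ^ 3) * mth := mul_le_mul (mul_le_mul_of_nonneg_left hs3 (by positivity))
          hmth (by positivity) (by positivity)
      _ = Real.pi * a * mth / s ^ 3 := by field_simp
  -- middle: `16πaρ = 128M³√ρ · πa√ρ/(8M³) ≤ πa√ρ/(8M³)`
  have h3 : 16 * Real.pi * a * ρ ≤ Real.pi * a * Real.sqrt ρ / (8 * M ^ 3) := by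
    have hρρ : Real.sqrt ρ * Real.sqrt ρ = ρ := Real.mul_self_sqrt hρ.le
    have hpos : 0 < Real.pi * a * Real.sqrt ρ / (8 * M ^ 3) := by positivity
    calc 16 * Real.pi * a * ρ = 16 * Real.pi * a * (Real.sqrt ρ * Real.sqrt ρ) := by rw [hρρ]
      _ = (128 * M ^ 3 * Real.sqrt ρ) * (Real.pi * a * Real.sqrt ρ / (8 * M ^ 3)) := by
          field_simp; ring
      _ ≤ 1 * (Real.pi * a * Real.sqrt ρ / (8 * M ^ 3)) := mul_le_mul_of_nonneg_right hpar hpos.le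
      _ = _ := one_mul _
  linarith

/-- **The budget of the no-clumping inequality at the mesoscopic scale.**  With
`U = 4πρa(1 + t)N + 1`, `A = (1-θ)(4πa/s³)N²/K`, `b₀ = (1-θ)(8πa/s³)(N/K)`, `B = 2K·λ·b₀`,
`N/K = ρs³` and `M/√ρ ≤ s ≤ 2M/√ρ`, `0 ≤ θ ≤ 1/2`: if `t + θ + 4λ̄√ρ/M³ ≤ η²/2` and
`2πaρη²N ≥ 1` then `U + B - A ≤ b₀η · ηN`. [folklore] -/
theorem noClumpingBudget_le {t lam lambar θ N K η : ℝ} (hM : 0 < M) (ha : 0 < a) (hρ : 0 < ρ)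
    (hsl : M / Real.sqrt ρ ≤ s) (hθ0 : 0 ≤ θ) (hθ1 : θ ≤ 1 / 2) (hlam0 : 0 ≤ lam)
    (hlam : lam ≤ lambar) (hN0 : 0 ≤ N) (hK : 0 < K) (hKN : N / K = ρ * s ^ 3)
    (hpar : t + θ + 4 * (lambar * Real.sqrt ρ) / M ^ 3 ≤ η ^ 2 / 2)
    (hN : 1 ≤ 2 * Real.pi * a * ρ * η ^ 2 * N) :
    4 * Real.pi * ρ * a * (1 + t) * N + 1 +
        2 * K * lam * ((1 - θ) * (8 * Real.pi * a / s ^ 3) * (N / K)) -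
          (1 - θ) * (4 * Real.pi * a / s ^ 3) * N ^ 2 / K ≤
      (1 - θ) * (8 * Real.pi * a / s ^ 3) * (N / K) * η * (η * N) := by
  have hsr : 0 < Real.sqrt ρ := Real.sqrt_pos.2 hρ
  have hs : 0 < s := lt_of_lt_of_le (by positivity) hsl
  -- `K = N/(ρ s³)` bookkeeping
  have hKeq : K * (ρ * s ^ 3) = N := by
    field_simp at hKN; linarith [hKN]
  have hA : (1 - θ) * (4 * Real.pi * a / s ^ 3) * N ^ 2 / K = (1 - θ) * 4 * Real.pi * a * ρ * N := by
    have h1 : N ^ 2 / K = N * (N / K) := by rw [pow_two, mul_div_assoc]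
    rw [mul_div_assoc, h1, hKN]
    field_simp
  have hB : 2 * K * lam * ((1 - θ) * (8 * Real.pi * a / s ^ 3) * (N / K)) =
      16 * Real.pi * a * ((1 - θ) * lam) * N * (1 / s ^ 3) := by
    field_simp
    ring
  have hP : (1 - θ) * (8 * Real.pi * a / s ^ 3) * (N / K) * η * (η * N) =
      (1 - θ) * 8 * Real.pi * a * ρ * η ^ 2 * N := by
    rw [hKN]; field_simp
  rw [hA, hB, hP]
  -- the scale bound and the pieces
  have hs3 := inv_cube_le_of_scale hM hρ hsl
  have hlb : 0 ≤ lambar := hlam0.trans hlam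
  have h1 : (1 - θ) * lam ≤ lambar := by nlinarith
  have hT2 : 16 * Real.pi * a * ((1 - θ) * lam) * N * (1 / s ^ 3) ≤
      16 * Real.pi * a * lambar * N * (ρ * Real.sqrt ρ / M ^ 3) := by
    gcongr
  have hT3 : 4 * Real.pi * ρ * a * (1 + t) * N - (1 - θ) * 4 * Real.pi * a * ρ * N +
      16 * Real.pi * a * lambar * N * (ρ * Real.sqrt ρ / M ^ 3) =
      4 * Real.pi * a * ρ * N * (t + θ + 4 * (lambar * Real.sqrt ρ) / M ^ 3) := by
    field_simp
    ring
  have hT4 : 4 * Real.pi * a * ρ * N * (t + θ + 4 * (lambar * Real.sqrt ρ) / M ^ 3) ≤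
      4 * Real.pi * a * ρ * N * (η ^ 2 / 2) := mul_le_mul_of_nonneg_left hpar (by positivity)
  have hT5 : 4 * Real.pi * a * ρ * η ^ 2 * N ≤ (1 - θ) * 8 * Real.pi * a * ρ * η ^ 2 * N := by
    have : 0 ≤ Real.pi * a * ρ * η ^ 2 * N := by positivity
    nlinarith
  nlinarith

end Budget

/-! ### Smallness of the parameters in the dilute limit -/

section Dilute

/-- **The no-clumping parameters are eventually small.**  For fixed positive scattering length `a`
and scale factor `M` (and any constants `C₁`, `C_u`), for every `ε > 0` and all sufficiently small
`ρ`: `C_u(ρa³)^{1/3} + C₁Y_max^{1/17} + 4λ̄√ρ/M³ ≤ ε` (each term is a constant times a positive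
power of `√ρ`) and `128M³√ρ ≤ 1`. [folklore] -/
theorem noClumpingParams_eventually {a M C₁ Cu ε : ℝ} (ha : 0 < a) (hM : 0 < M) (hε : 0 < ε) :
    ∃ ρ₀ : ℝ, 0 < ρ₀ ∧ ∀ ρ : ℝ, 0 < ρ → ρ < ρ₀ →
      Cu * (ρ * a ^ 3) ^ ((1 : ℝ) / 3) +
          C₁ * (8 * Real.pi * a ^ 3 * Real.sqrt ρ / (3 * M ^ 3)) ^ ((1 : ℝ) / 17) +
          4 * ((6 * M ^ 3 / (Real.pi * a ^ 3 * (ρ * Real.sqrt ρ))) ^ ((1 : ℝ) / 18) * Real.sqrt ρ) /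
            M ^ 3 ≤ ε ∧
      128 * M ^ 3 * Real.sqrt ρ ≤ 1 := by
  -- adapted from `floorParams_eventually` / `floorBudgetSum_eventually_le`
  set Ymax : ℝ → ℝ := fun ρ => 8 * Real.pi * a ^ 3 * Real.sqrt ρ / (3 * M ^ 3) with hYmax
  set c18 : ℝ := (6 * M ^ 3 / (Real.pi * a ^ 3)) ^ ((1 : ℝ) / 18) with hc18
  -- (1) `Ymax → 0`, `Ymax^{1/17} → 0`
  have hY : Tendsto Ymax (𝓝[>] 0) (𝓝 0) :=
    tendsto_zero_of_eq_const_mul_sqrt_rpow (8 * Real.pi * a ^ 3 / (3 * M ^ 3)) one_pos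
      (fun ρ _ => by rw [hYmax]; simp only [Real.rpow_one]; ring)
  have hY17 : Tendsto (fun ρ => Ymax ρ ^ ((1 : ℝ) / 17)) (𝓝[>] 0) (𝓝 0) := by
    have := (Real.continuousAt_rpow_const 0 ((1 : ℝ) / 17) (Or.inr (by norm_num))).tendsto
    simp only [Real.zero_rpow (by norm_num : ((1 : ℝ) / 17) ≠ 0)] at this
    exact this.comp hY
  -- (2) `(ρa³)^{1/3} → 0`
  have ht3 : Tendsto (fun ρ : ℝ => (ρ * a ^ 3) ^ ((1 : ℝ) / 3)) (𝓝[>] 0) (𝓝 0) := by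
    have hc : Continuous fun ρ : ℝ => (ρ * a ^ 3) ^ ((1 : ℝ) / 3) :=
      (continuous_id.mul continuous_const).rpow_const fun _ => Or.inr (by norm_num)
    have := hc.tendsto 0
    simp only [zero_mul, Real.zero_rpow (by norm_num : ((1 : ℝ) / 3) ≠ 0)] at this
    exact this.mono_left nhdsWithin_le_nhds
  -- (3) `lambar √ρ = c18 (√ρ)^{5/6}`
  have hlam : ∀ ρ : ℝ, 0 < ρ →
      (6 * M ^ 3 / (Real.pi * a ^ 3 * (ρ * Real.sqrt ρ))) ^ ((1 : ℝ) / 18) * Real.sqrt ρ =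
        c18 * Real.sqrt ρ ^ ((5 : ℝ) / 6) := by
    intro ρ hρ
    have ht : 0 < Real.sqrt ρ := Real.sqrt_pos.2 hρ
    have hρt : ρ * Real.sqrt ρ = Real.sqrt ρ ^ (3 : ℝ) := by
      rw [show (3 : ℝ) = 2 + 1 by norm_num, Real.rpow_add ht, Real.rpow_two, Real.sq_sqrt hρ.le,
        Real.rpow_one]
    have h1 : 6 * M ^ 3 / (Real.pi * a ^ 3 * (ρ * Real.sqrt ρ)) =
        (6 * M ^ 3 / (Real.pi * a ^ 3)) * Real.sqrt ρ ^ (-(3 : ℝ)) := by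
      rw [hρt, Real.rpow_neg ht.le]; field_simp
    rw [h1, Real.mul_rpow (by positivity) (Real.rpow_nonneg ht.le _), ← Real.rpow_mul ht.le, hc18,
      mul_assoc, ← Real.rpow_add_one ht.ne']
    norm_num
  have hlamt : Tendsto (fun ρ : ℝ =>
      (6 * M ^ 3 / (Real.pi * a ^ 3 * (ρ * Real.sqrt ρ))) ^ ((1 : ℝ) / 18) * Real.sqrt ρ)
      (𝓝[>] 0) (𝓝 0) :=
    tendsto_zero_of_eq_const_mul_sqrt_rpow c18 (by norm_num) hlam
  -- (4) `128 M³ √ρ → 0`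
  have h128 : Tendsto (fun ρ : ℝ => 128 * M ^ 3 * Real.sqrt ρ) (𝓝[>] 0) (𝓝 0) :=
    tendsto_zero_of_eq_const_mul_sqrt_rpow (128 * M ^ 3) one_pos
      (fun ρ _ => by rw [Real.rpow_one])
  -- (5) the sum → 0
  have hsum : Tendsto (fun ρ : ℝ => Cu * (ρ * a ^ 3) ^ ((1 : ℝ) / 3) + C₁ * Ymax ρ ^ ((1 : ℝ) / 17) +
      4 * ((6 * M ^ 3 / (Real.pi * a ^ 3 * (ρ * Real.sqrt ρ))) ^ ((1 : ℝ) / 18) * Real.sqrt ρ) / M ^ 3)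
      (𝓝[>] 0) (𝓝 0) := by
    simpa using ((ht3.const_mul Cu).add (hY17.const_mul C₁)).add ((hlamt.const_mul 4).div_const (M ^ 3))
  have e1 := (tendsto_order.1 hsum).2 ε hε
  have e2 := (tendsto_order.1 h128).2 1 one_pos
  refine exists_pos_forall_of_eventually ?_
  filter_upwards [e1, e2] with ρ h1 h2
  exact ⟨h1.le, h2.le⟩

end Dilute

/-! ## No clumping at the mesoscopic scale -/

section Final

/-- The number of dyadic cells of level `k`, as a real number: `(2^k)³ = 8^k`. [folklore] -/
theorem natCast_two_pow_pow_three (k : ℕ) : (((2 ^ k) ^ 3 : ℕ) : ℝ) = 8 ^ k := by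
  push_cast
  rw [← pow_mul, mul_comm, pow_mul]
  norm_num

/-- **No clumping of Dirichlet near-minimisers at the mesoscopic scale.**  For a repulsive
finite-range `v` with positive scattering length, every `0 < η ≤ 1` and every `M > 0` there is
`ρ₀ = ρ₀(η, M, v) > 0` such that for `0 < ρ < ρ₀`, eventually in `N`, every `1`-near-minimiser `Ψ`
of the Dirichlet energy in the box of side `L = (N/ρ)^{1/3}` and every dyadic level `k` with
`M/√ρ ≤ L/2^k < 2M/√ρ` satisfy: distributing the particles of a configuration over the `8^k`
cells of side `s = L/2^k` (assignments `σ`, occupation numbers `n_c(σ)`, weights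
`mass_σ = ∫_{cellSet σ}|Ψ|²`), the mass-averaged total excess over the fair share `(1+η)N/8^k` is
at most `ηN`: `Σ_σ mass_σ Σ_c (n_c(σ) - (1+η)N/8^k)₊ ≤ ηN`.  Mechanism: the cell method
[LSSY (2.52)] state-wise
(`mul_sum_mass_mul_excess_le`) with the convexity bookkeeping keeping the linear excess
(`occupation_bookkeeping_excess`: `Σ_c n_c² - N n̄ = Σ_c (n_c - n̄)² ≥ 2ηn̄ Σ_c (n_c - (1+η)n̄)₊` in
the Lieb–Yngvason regime, `locLowerBound_neumann` / `LSSY2005_lowerBound_neumann_holds` plus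
superadditivity in the crowded cells), against the Dyson upper bound
`eventually_groundStateEnergy_le_dyson`: the mass-averaged excess is
`≤ N(C_u(ρa³)^{1/3} + C₁Y^{1/17} + 4λ̄√ρ/M³)/η + 1/(4πaρη) ≤ ηN` for `ρ < ρ₀(η, M, v)` and large `N`.
(False for zero scattering length: the free Dirichlet ground state `∏ sin` puts up to `8×` the fair
share into the central cells.) [folklore] -/
theorem sum_mass_mul_excess_le_of_scatteringLength_pos {v : ℝ → ℝ≥0∞}
    (hv : IsRepulsiveFiniteRange v) (hapos : 0 < scatteringLength v) {η : ℝ} (hη : 0 < η)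
    (hη1 : η ≤ 1) {M : ℝ} (hM : 0 < M) :
    ∃ ρ₀ : ℝ, 0 < ρ₀ ∧ ∀ ρ : ℝ, 0 < ρ → ρ < ρ₀ →
      ∀ᶠ N : ℕ in atTop, ∀ Ψ : TrialState N (sideLength ρ N),
        energy v Ψ ≤ groundStateEnergy v N (sideLength ρ N) + 1 →
        ∀ k : ℕ, M / Real.sqrt ρ ≤ sideLength ρ N / 2 ^ k →
          sideLength ρ N / 2 ^ k < 2 * (M / Real.sqrt ρ) →
            ∑ σ : Fin N → Fin ((2 ^ k) ^ 3),
              (∫⁻ X in cellSet (2 ^ k) (sideLength ρ N / 2 ^ k) σ, (‖Ψ.ψ X‖₊ : ℝ≥0∞) ^ 2) *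
                ∑ c, (((Finset.univ.filter fun j => σ j = c).card : ℝ≥0∞) -
                  ENNReal.ofReal ((1 + η) * N / 8 ^ k)) ≤ ENNReal.ofReal (η * N) := by
  obtain ⟨R₀, hR₀⟩ := hv.2
  have hfin : scatteringLength v ≠ ⊤ := scatteringLength_ne_top_of_finiteRange hR₀
  set a : ℝ := (scatteringLength v).toReal with ha_def
  have ha : 0 < a := ENNReal.toReal_pos hapos.ne' hfin
  obtain ⟨δ₁, C₁, hδ₁, hC₁, Hloc⟩ := locLowerBound_neumann v hv
  obtain ⟨δ₂, C₂, C₂', hδ₂, hC₂, hC₂', HLY⟩ := LSSY2005_lowerBound_neumann_holds v hv hfin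
  obtain ⟨Cu, ρu, hCu, hρu, Hup⟩ := eventually_groundStateEnergy_le_dyson hR₀ hv.1 hfin hapos
  obtain ⟨ρp, hρp, Hpar⟩ := floorParams_eventually (C₁ := C₁) (C₂ := C₂) (C₂' := C₂') (C₄ := 1)
    (Cu := Cu) ha hM hδ₁ hδ₂
  obtain ⟨ρb, hρb, Hbud⟩ := noClumpingParams_eventually (C₁ := C₁) (Cu := Cu) ha hM
    (half_pos (pow_pos hη 2))
  refine ⟨min (min ρp ρu) ρb, lt_min (lt_min hρp hρu) hρb, fun ρ hρ hρlt => ?_⟩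
  have hρp' : ρ < ρp := lt_of_lt_of_le hρlt ((min_le_left _ _).trans (min_le_left _ _))
  have hρu' : ρ < ρu := lt_of_lt_of_le hρlt ((min_le_left _ _).trans (min_le_right _ _))
  have hρb' : ρ < ρb := lt_of_lt_of_le hρlt (min_le_right _ _)
  obtain ⟨hρ1, hYδ₁, hYδ₂, hy12, hθ12, hC2y, hbox, -, ht1, -⟩ := Hpar ρ hρ hρp'
  obtain ⟨hsmall, h128⟩ := Hbud ρ hρ hρb'
  have hsr : 0 < Real.sqrt ρ := Real.sqrt_pos.2 hρ
  obtain ⟨hmth1, hmth2, hmth3⟩ := ceil_inv_bounds hρ hρ1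
  set mth : ℕ := ⌈ρ⁻¹⌉₊ with hmth_def
  have hmthr : (0 : ℝ) < mth := by exact_mod_cast hmth3
  -- density-only quantities
  set Ymax : ℝ := 8 * Real.pi * a ^ 3 * Real.sqrt ρ / (3 * M ^ 3) with hYmax
  set θ : ℝ := C₁ * Ymax ^ ((1 : ℝ) / 17) with hθ_def
  have hθ0 : 0 ≤ θ := by positivity
  have hθ1 : θ ≤ 1 / 2 := hθ12
  set lambar : ℝ := (6 * M ^ 3 / (Real.pi * a ^ 3 * (ρ * Real.sqrt ρ))) ^ ((1 : ℝ) / 18) with hlambar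
  set t : ℝ := Cu * (ρ * a ^ 3) ^ ((1 : ℝ) / 3) with ht_def
  have ht0 : 0 ≤ t := by positivity
  -- thresholds in `N`
  filter_upwards [Hup ρ hρ hρu',
    tendsto_natCast_atTop_atTop.eventually_ge_atTop (1 / (2 * Real.pi * a * ρ * η ^ 2)),
    eventually_gt_atTop 0] with N hUp hN1 hNpos Ψ hΨ k hk1 hk2
  obtain ⟨n, rfl⟩ : ∃ n, N = n + 1 := ⟨N - 1, by omega⟩
  have hN1' : 1 ≤ 2 * Real.pi * a * ρ * η ^ 2 * ((n + 1 : ℕ) : ℝ) := by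
    rw [div_le_iff₀ (by positivity)] at hN1; linarith
  have hNr : (0 : ℝ) ≤ ((n + 1 : ℕ) : ℝ) := Nat.cast_nonneg _
  -- the scale
  set s : ℝ := sideLength ρ (n + 1) / 2 ^ k with hs_def
  have hs : 0 < s := lt_of_lt_of_le (by positivity) hk1
  have hsl : M / Real.sqrt ρ ≤ s := hk1
  have hsu : s ≤ 2 * M / Real.sqrt ρ := by rw [mul_div_assoc]; exact hk2.le
  have hL : 0 < sideLength ρ (n + 1) := sideLength_pos_of_pos hρ (Nat.succ_pos n)
  have hK : 0 < 2 ^ k := pow_pos two_pos k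
  have hKs : ((2 ^ k : ℕ) : ℝ) * s = sideLength ρ (n + 1) := by
    rw [hs_def]; push_cast; field_simp
  have hKc : (0 : ℝ) < (((2 ^ k) ^ 3 : ℕ) : ℝ) := by positivity
  have hKN : (((n + 1 : ℕ) : ℝ)) / (((2 ^ k) ^ 3 : ℕ) : ℝ) = ρ * s ^ 3 := by
    have h3 := sideLength_pow_three hρ (n + 1)
    rw [← hKs] at h3
    push_cast at h3
    rw [div_eq_iff hKc.ne']
    push_cast
    field_simp at h3
    linarith [h3]
  -- cell quantities
  set Yc : ℕ → ℝ := fun m => 4 * Real.pi * ((m : ℝ) / s ^ 3) * a ^ 3 / 3 with hYc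
  have hYc0 : ∀ m, 0 ≤ Yc m := fun m => by rw [hYc]; positivity
  set good : ℕ → Prop := fun m => Yc m ^ (-(1 : ℝ) / 17) ≤ m ∧ (m : ℝ) ≤ mth with hgood
  set yf : ℕ → ℝ := fun m => Yc m ^ ((1 : ℝ) / 17) with hyf
  set Rf : ℕ → ℝ := fun m => a * Yc m ^ (-(5 : ℝ) / 17) with hRf
  set LYval : ℝ := 4 * Real.pi * ((mth : ℝ) / s ^ 3) * a * (1 - C₂ * Yc mth ^ ((1 : ℝ) / 17)) * mth
    with hLYval
  set lb : ℕ → ℝ := fun m => if good m then 4 * Real.pi * ((m : ℝ) / s ^ 3) * a * (1 - C₁ * yf m) * m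
    else if (m : ℝ) ≤ mth then 0 else ((m / mth : ℕ) : ℝ) * LYval with hlb
  set lam : ℝ := (3 * s ^ 3 / (4 * Real.pi * a ^ 3)) ^ ((1 : ℝ) / 18) with hlam
  set Ur : ℝ := 4 * Real.pi * ρ * a * (1 + t) * ((n + 1 : ℕ) : ℝ) + 1 with hUr
  set A : ℝ := (1 - θ) * (4 * Real.pi * a / s ^ 3) * (((n + 1 : ℕ) : ℝ)) ^ 2 / (((2 ^ k) ^ 3 : ℕ) : ℝ)
    with hA_def
  set b₀ : ℝ := (1 - θ) * (8 * Real.pi * a / s ^ 3) * ((((n + 1 : ℕ) : ℝ)) / (((2 ^ k) ^ 3 : ℕ) : ℝ))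
    with hb₀_def
  set B : ℝ := 2 * (((2 ^ k) ^ 3 : ℕ) : ℝ) * lam * b₀ with hB_def
  set cap : ℝ := (1 + η) * ((n + 1 : ℕ) : ℝ) / (((2 ^ k) ^ 3 : ℕ) : ℝ) with hcap_def
  -- density bounds for good cells and at the threshold
  have hYmax_bd : ∀ m : ℕ, (m : ℝ) ≤ mth → Yc m ≤ Ymax := fun m hm =>
    cellY_le_Ymax ha hM hρ hsl hm hmth2
  have hYmin_bd : Real.pi * a ^ 3 * Real.sqrt ρ / (6 * M ^ 3) ≤ Yc mth :=
    Ymin_le_cellY ha hM hρ hsu hs hmth1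
  have hθm : ∀ m : ℕ, (m : ℝ) ≤ mth → C₁ * yf m ≤ θ := fun m hm => by
    rw [hyf, hθ_def]
    exact mul_le_mul_of_nonneg_left (Real.rpow_le_rpow (hYc0 m) (hYmax_bd m hm) (by norm_num)) hC₁.le
  have hC2m : C₂ * Yc mth ^ ((1 : ℝ) / 17) ≤ 1 / 2 :=
    le_trans (mul_le_mul_of_nonneg_left (Real.rpow_le_rpow (hYc0 mth) (hYmax_bd mth le_rfl)
      (by norm_num)) hC₂.le) hC2y
  have hLYval : 2 * Real.pi * a * (mth : ℝ) ^ 2 / s ^ 3 ≤ LYval := by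
    rw [hLYval]
    have h1 : (1 : ℝ) / 2 ≤ 1 - C₂ * Yc mth ^ ((1 : ℝ) / 17) := by linarith
    calc 2 * Real.pi * a * (mth : ℝ) ^ 2 / s ^ 3
        = 4 * Real.pi * ((mth : ℝ) / s ^ 3) * a * (1 / 2) * mth := by field_simp; ring
      _ ≤ 4 * Real.pi * ((mth : ℝ) / s ^ 3) * a * (1 - C₂ * Yc mth ^ ((1 : ℝ) / 17)) * mth := by
          gcongr
  have hLYval0 : 0 ≤ LYval := le_trans (by positivity) hLYval
  ----------------------------------------------------------------
  -- the cell lower bounds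
  ----------------------------------------------------------------
  have hy : ∀ m, good m → 0 ≤ yf m ∧ yf m ≤ 1 / 2 := by
    intro m hg
    refine ⟨Real.rpow_nonneg (hYc0 m) _, ?_⟩
    exact le_trans (Real.rpow_le_rpow (hYc0 m) (hYmax_bd m hg.2) (by norm_num)) hy12
  have hloc : ∀ m, good m → ENNReal.ofReal (lb m) ≤ locGroundStateEnergy (yf m) (Rf m) v m s := by
    intro m hg
    have hlbm : lb m = 4 * Real.pi * ((m : ℝ) / s ^ 3) * a * (1 - C₁ * yf m) * m := by
      rw [hlb]; simp only [hg, if_true]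
    rw [hlbm]
    rcases Nat.eq_zero_or_pos m with rfl | hmpos
    · simp
    have hY1 : Yc m < δ₁ := lt_of_le_of_lt (hYmax_bd m hg.2) hYδ₁
    have hY2 : Yc m ^ (-(6 : ℝ) / 17) < s / a := rpow_lt_div_of_le hmpos hs ha hg.1
    exact Hloc m s hs hY1 hY2
  have hE0 : ∀ m, ¬ good m → ENNReal.ofReal (lb m) ≤ neumannGroundStateEnergy v m s := by
    intro m hg
    by_cases hm : (m : ℝ) ≤ mth
    · have : lb m = 0 := by rw [hlb]; simp only [hg, if_false, hm, if_true]
      rw [this, ENNReal.ofReal_zero]; exact bot_le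
    · have hlbm : lb m = ((m / mth : ℕ) : ℝ) * LYval := by
        rw [hlb]; simp only [hg, if_false, hm]
      rw [hlbm, ENNReal.ofReal_mul (Nat.cast_nonneg _), ENNReal.ofReal_natCast]
      -- the Lieb–Yngvason bound in the cell at the threshold occupation
      have hY1 : Yc mth < δ₂ := lt_of_le_of_lt (hYmax_bd mth le_rfl) hYδ₂
      have hY2 : C₂' * Yc mth ^ (-(6 : ℝ) / 17) < s / a := by
        have h1 : Yc mth ^ (-(6 : ℝ) / 17) ≤
            (Real.pi * a ^ 3 * Real.sqrt ρ / (6 * M ^ 3)) ^ (-(6 : ℝ) / 17) :=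
          Real.rpow_le_rpow_of_nonpos (by positivity) hYmin_bd (by norm_num)
        have h2 : M / (a * Real.sqrt ρ) ≤ s / a := by
          rw [div_le_div_iff₀ (by positivity) ha]
          have h3 : M ≤ s * Real.sqrt ρ := (div_le_iff₀ hsr).1 hsl
          calc M * a ≤ s * Real.sqrt ρ * a := by gcongr
            _ = s * (a * Real.sqrt ρ) := by ring
        exact lt_of_le_of_lt (mul_le_mul_of_nonneg_left h1 hC₂'.le) (hbox.trans_le h2)
      have hLY : ENNReal.ofReal LYval ≤ neumannGroundStateEnergy v mth s := HLY mth s hs hY1 hY2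
      have hsup := LSSY2005_superadditivity_holds.mul_le hv.1 hs mth (m / mth) (m % mth)
      rw [Nat.div_add_mod'] at hsup
      exact le_trans (mul_le_mul_right hLY _) hsup
  have hlbN : ∀ m, ENNReal.ofReal (lb m) ≤ neumannGroundStateEnergy v m s := by
    intro m
    by_cases hg : good m
    · obtain ⟨hy0, hy1⟩ := hy m hg
      exact (hloc m hg).trans
        (locGroundStateEnergy_le_neumannGroundStateEnergy hy0 (by linarith) _ _ _ _)
    · exact hE0 m hg
  ----------------------------------------------------------------
  -- the occupation bookkeeping with the linear excess
  ----------------------------------------------------------------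
  have hκcond : 2 * b₀ ≤ Real.pi * a * mth / s ^ 3 := by
    rw [hb₀_def, hKN]
    exact crowding_condition ha hM hρ hsu hs hθ0 hmth1 h128
  have hcomb : ∀ nv : Fin ((2 ^ k) ^ 3) → ℕ, ∑ c, nv c = n + 1 →
      ENNReal.ofReal A + ENNReal.ofReal (b₀ * η) * ∑ c, ((nv c : ℝ≥0∞) - ENNReal.ofReal cap) ≤
        (∑ c, ENNReal.ofReal (lb (nv c))) + ENNReal.ofReal B := by
    intro nv hsum
    have h := occupation_bookkeeping_excess (mth := mth) good lb (lam := lam)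
      (κh := Real.pi * a * mth / s ^ 3) (η := η) hs ha.le (by linarith) (by positivity) hη.le hη1
      ?_ ?_ ?_ hκcond nv hsum
    · rw [hA_def, hB_def, hcap_def, hb₀_def]
      exact h
    · -- good cells
      intro m hg
      have hlbm : lb m = 4 * Real.pi * ((m : ℝ) / s ^ 3) * a * (1 - C₁ * yf m) * m := by
        rw [hlb]; simp only [hg, if_true]
      rw [hlbm]
      have h1 : C₁ * yf m ≤ θ := hθm m hg.2
      have h2 : 0 ≤ 4 * Real.pi * a / s ^ 3 * (m : ℝ) ^ 2 := by positivity
      calc (1 - θ) * (4 * Real.pi * a / s ^ 3) * (m : ℝ) ^ 2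
          = (1 - θ) * (4 * Real.pi * a / s ^ 3 * (m : ℝ) ^ 2) := by ring
        _ ≤ (1 - C₁ * yf m) * (4 * Real.pi * a / s ^ 3 * (m : ℝ) ^ 2) :=
            mul_le_mul_of_nonneg_right (by linarith) h2
        _ = _ := by ring
    · -- low cells
      intro m hg hm
      have hlbm : lb m = 0 := by rw [hlb]; simp only [hg, if_false, hm, if_true]
      refine ⟨hlbm.ge, ?_⟩
      have hng : ¬ (Yc m ^ (-(1 : ℝ) / 17) ≤ m) := fun h => hg ⟨h, hm⟩
      exact (lt_lam_of_not_rpow_le ha hs hng).2.le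
    · -- high cells
      intro m hg hm
      have hm' : ¬ ((m : ℝ) ≤ mth) := not_le.2 hm
      have hlbm : lb m = ((m / mth : ℕ) : ℝ) * LYval := by rw [hlb]; simp only [hg, if_false, hm']
      rw [hlbm]
      have hmn : mth < m := by exact_mod_cast hm
      have hq := div_two_mul_le_nat_div hmth3 hmn
      calc Real.pi * a * mth / s ^ 3 * m = (m : ℝ) / (2 * mth) * (2 * Real.pi * a * (mth : ℝ) ^ 2 / s ^ 3) := by
            field_simp
        _ ≤ ((m / mth : ℕ) : ℝ) * LYval := mul_le_mul hq hLYval (by positivity) (Nat.cast_nonneg _)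
  ----------------------------------------------------------------
  -- the energy budget
  ----------------------------------------------------------------
  have hE : energy v Ψ ≤ ENNReal.ofReal Ur := by
    refine hΨ.trans ?_
    rw [hUr, ENNReal.ofReal_add (by positivity) zero_le_one, ENNReal.ofReal_one]
    exact add_le_add hUp le_rfl
  have hUr0 : 0 ≤ Ur := by rw [hUr]; positivity
  have hA0 : 0 ≤ A := by
    rw [hA_def]
    have : 0 ≤ 1 - θ := by linarith
    positivity
  have hlam0 : 0 ≤ lam := by rw [hlam]; positivity
  have hb₀pos : 0 < b₀ := by
    rw [hb₀_def, hKN]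
    have : 0 < 1 - θ := by linarith
    positivity
  have hB0 : 0 ≤ B := by rw [hB_def]; positivity
  have hmain := mul_sum_mass_mul_excess_le hs hK hKs hv.1 Ψ lb hUr0 hA0 hB0 hlbN hcomb hE
  have hbudget : Ur + B - A ≤ b₀ * η * (η * ((n + 1 : ℕ) : ℝ)) := by
    have hlamle : lam ≤ lambar := lam_le_lambar ha hM hρ hsu hs
    have h := noClumpingBudget_le (t := t) (lam := lam) (lambar := lambar) (θ := θ) (η := η)
      (N := ((n + 1 : ℕ) : ℝ)) (K := (((2 ^ k) ^ 3 : ℕ) : ℝ)) hM ha hρ hsl hθ0 hθ1 hlam0 hlamle hNr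
      hKc hKN hsmall hN1'
    rw [hUr, hB_def, hA_def, hb₀_def]
    linarith [h]
  have hP0 : 0 < b₀ * η := mul_pos hb₀pos hη
  have hX : ∑ σ : Fin (n + 1) → Fin ((2 ^ k) ^ 3),
      (∫⁻ X in cellSet (2 ^ k) s σ, (‖Ψ.ψ X‖₊ : ℝ≥0∞) ^ 2) *
        ∑ c, (((Finset.univ.filter fun i => σ i = c).card : ℝ≥0∞) - ENNReal.ofReal cap) ≤
      ENNReal.ofReal (η * ((n + 1 : ℕ) : ℝ)) := by
    have h := hmain.trans (ENNReal.ofReal_le_ofReal hbudget)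
    rw [ENNReal.ofReal_mul hP0.le] at h
    exact (ENNReal.mul_le_mul_iff_right (ENNReal.ofReal_pos.2 hP0).ne' ENNReal.ofReal_ne_top).1 h
  have hcapE : ENNReal.ofReal ((1 + η) * ((n + 1 : ℕ) : ℝ) / 8 ^ k) = ENNReal.ofReal cap := by
    rw [hcap_def, natCast_two_pow_pow_three]
  rw [hcapE]
  exact hX

/-- **No clumping, Jensen form.**  Under the same hypotheses, the mass-averaged occupation
numbers `N_c = Σ_σ mass_σ n_c(σ)` of the `8^k` cells (the expected numbers of particles in the
cells) exceed the fair share by at most `ηN` in total: `Σ_c (N_c - (1+η)N/8^k)₊ ≤ ηN`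
(`sum_tsub_le_sum_mul_sum_tsub`, `Σ_σ mass_σ = 1`). [folklore] -/
theorem sum_massAverage_card_tsub_le_of_scatteringLength_pos {v : ℝ → ℝ≥0∞}
    (hv : IsRepulsiveFiniteRange v) (hapos : 0 < scatteringLength v) {η : ℝ} (hη : 0 < η)
    (hη1 : η ≤ 1) {M : ℝ} (hM : 0 < M) :
    ∃ ρ₀ : ℝ, 0 < ρ₀ ∧ ∀ ρ : ℝ, 0 < ρ → ρ < ρ₀ →
      ∀ᶠ N : ℕ in atTop, ∀ Ψ : TrialState N (sideLength ρ N),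
        energy v Ψ ≤ groundStateEnergy v N (sideLength ρ N) + 1 →
        ∀ k : ℕ, M / Real.sqrt ρ ≤ sideLength ρ N / 2 ^ k →
          sideLength ρ N / 2 ^ k < 2 * (M / Real.sqrt ρ) →
            ∑ c : Fin ((2 ^ k) ^ 3), ((∑ σ : Fin N → Fin ((2 ^ k) ^ 3),
                (∫⁻ X in cellSet (2 ^ k) (sideLength ρ N / 2 ^ k) σ, (‖Ψ.ψ X‖₊ : ℝ≥0∞) ^ 2) *
                  ((Finset.univ.filter fun j => σ j = c).card : ℝ≥0∞)) -
                ENNReal.ofReal ((1 + η) * N / 8 ^ k)) ≤ ENNReal.ofReal (η * N) := by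
  obtain ⟨ρ₀, hρ₀, H⟩ := sum_mass_mul_excess_le_of_scatteringLength_pos hv hapos hη hη1 hM
  refine ⟨ρ₀, hρ₀, fun ρ hρ hρlt => ?_⟩
  filter_upwards [H ρ hρ hρlt, eventually_gt_atTop 0] with N hN hNpos Ψ hΨ k hk1 hk2
  have hL : 0 < sideLength ρ N := sideLength_pos_of_pos hρ hNpos
  set s : ℝ := sideLength ρ N / 2 ^ k with hs_def
  have hs : 0 < s := by positivity
  have hK : 0 < 2 ^ k := pow_pos two_pos k
  have hKs : ((2 ^ k : ℕ) : ℝ) * s = sideLength ρ N := by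
    rw [hs_def]; push_cast; field_simp
  have hmass1 := sum_mass_cellSet_eq_one hs hK hKs Ψ
  exact (sum_tsub_le_sum_mul_sum_tsub _ hmass1
    (fun (σ : Fin N → Fin ((2 ^ k) ^ 3)) c => ((Finset.univ.filter fun j => σ j = c).card : ℝ≥0∞))
    _).trans (hN Ψ hΨ k hk1 hk2)

end Final

end Literature.MathematicalPhysics.QuantumManyBody.BoseGas

end
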